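import Summits.QuantumFields.YangMills.Theorems.UnitScaleTiltProp7TrueLinPureGaugeIter
import Summits.QuantumFields.YangMills.Theorems.UnitScaleTiltProp7TrueLinReducedStep
import HarnessLib

/-!
# Route `UnitScaleTilt`, crux K1 «MinimiserStabilityRegPr» (stmt-QuantumFields-19200), route-R — TRANSVERSALITY OF THE (0.4)-FIBRE TO THE FULL GAUGE
# ORBIT MODULO THE PINNED GROUP (4), LINEAR-ALGEBRA LAYER (row (R-ε) of the route-R lead, CARD-19200-V3-g12 §2′)

Cell `ym3-torus`, fleet lead `ym-ust-19200-p1` (gen 12).  THEOREMS ONLY (0 `def`, 0 `sorry`); `--supports stmt-QuantumFields-19200`, count-neutral.  YM₃ on T³ is a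
ladder rung (R3), not the Clay problem; nothing here is a claim about the stub, the crux, d = 4 or the mass gap.

THE POINT (numerics `g12/crit.py`, constrained critical points, ℓ = 3: every slice∕quotient — pinned, Landau, print's R-slice, Landau quotient — coincides within 1 %;
at random NON-critical model backgrounds a «twisted-toron» soft direction appears instead).  The structural reason is an identity, not an estimate: a tangent vector to
the fibre `ker Q` decomposes as «gauge part + rest», `Y = P_{U₀}ξ + G`, and the EXACT linearised gauge covariance of the true k-fold average
(✓ `Prop7TrueLinPureGaugeIter.trueLinIter_add_pureGauge`, ★w2-20520 g3: `Q k (G + P_{U₀}ξ) = Q k G + P_{Ū₀^{(k)}}(ξ ∘ embIter k)`) forces the COARSE shadow of the gauge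
part to be minus the average of the rest: `P_{Ū₀^{(k)}}(ξ ∘ embIter k)(c) = −(Q k G)(c)` at every coarse bond (§1).  Hence (§2) its bondwise norm and its `ℓ²`-mass are those
of `Q k G` — a near-stabiliser rotation of the coarse datum can enter a fibre tangent only with as much coarse weight as the NON-gauge part's average supplies; and (§3) the
fine-level mass of the near-constant lift of a rotation `K` is controlled by the background's bondwise distance to `1`: `‖K − U K U*‖ ≤ 2‖U − 1‖·‖K‖`.  Together these are
the two inputs of the «ℓ·roughness(U) vs holonomy(V)» criterion of the card; no estimate of Bałaban's is asserted.

WHAT IS PROVED (ns `…Theorems.Prop7FibreGaugeTransversality`; `SU(n)`, any `P`, any `k`, under the per-level (0.4) guards of the cited identity, displayed verbatim).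
* §1 ★★ `coarseGauge_eq_neg_avg_of_tangent` — `Q k (G + P_{U₀}ξ) = 0` at every coarse bond ⇒ `ξ(embIter k c₋) − Ū c·ξ(embIter k c₊)·(Ū c)* = −Q k G c`.
* §2 ★ `norm_coarseGauge_eq_of_tangent`, ★ `sum_normSq_coarseGauge_eq_of_tangent` — the bondwise norm and the `ℓ²`-mass versions.
* §3 (the bondwise `‖K − U K U*‖ ≤ 2‖U − 1‖‖K‖` is ★routeR's landed ✓`Prop7TrueLinReducedStep.norm_sub_conj_le`, cited) ★ `sum_normSq_constLift_le` — summed over bonds: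
  `Σ_b ‖K − U_b K U_b*‖² ≤ 4‖K‖²·Σ_b ‖U_b − 1‖²`.
HONEST SCOPE.  Corollaries of the cited identity + the triangle inequality; the content (gauge covariance of the TRUE linearisation) is ★w2-20520's landed theorem.

References: T. Bałaban, CMP 98 (1985) 17–51 [Balaban1985Averaging] ((11)–(13) p.19); CMP 102 (1985) 277–309 [Balaban1985Variational] ((4) p.278, (16) p.280).
-/

set_option autoImplicit false

noncomputable section

open scoped BigOperators Matrix.Norms.L2Operator

namespace Summit.QuantumFields.YangMills.Theorems.Prop7FibreGaugeTransversality

open Literature.MathematicalPhysics.QuantumFieldTheory.Balaban1983to89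
open Finset T4Continuum BlockAveraging AveragingRT ExpMeanLog BlockAveragingEMLLinearised BlockAveragingEMLLinearisedBackground BlockAveragingEMLProp2
open B15DeterminingSets (embIter)
open Summit.QuantumFields.YangMills.Theorems.Prop7TrueLinPureGaugeIter (trueLinIter_add_pureGauge)
open Summit.QuantumFields.YangMills.Theorems.Prop7TrueLinReducedStep (norm_sub_conj_le)

variable {P : Params} {n : Type*} [Fintype n] [DecidableEq n] [Nonempty n]

/-! ## §1 The coarse gauge shadow of a fibre tangent -/

/-- ★★ **THE COARSE GAUGE SHADOW OF A FIBRE TANGENT IS MINUS THE AVERAGE OF ITS NON-GAUGE PART.**  For the recursion family `Q` of the TRUE linearised k-fold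
(0.4)-average at a background `U₀` (letters `hQ0`, `hQs` of the cell), a fine gauge function `ξ` and a bond field `G`: if `Y := G + P_{U₀}ξ` is a fibre tangent at
level `k` (`Q k Y c = 0` for every coarse bond `c`), then `P_{Ū₀^{(k)}}(ξ ∘ embIter k)(c) = −(Q k G)(c)`.  [cite: Balaban1985Averaging, (11)-(13) p.19] -/
theorem coarseGauge_eq_neg_avg_of_tangent (U₀ : GaugeField P 0 (Matrix.specialUnitaryGroup n ℂ))
    (Q : (k : ℕ) → (PBond P 0 → Matrix n n ℂ) → PBond P k → Matrix n n ℂ) (hQ0 : ∀ Y, Q 0 Y = Y)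
    (hQs : ∀ (k : ℕ) (Y : PBond P 0 → Matrix n n ℂ) (c : PBond P (k + 1)), Q (k + 1) Y c
      = fderiv ℂ (eml : (Idx P → Matrix n n ℂ) → Matrix n n ℂ)
            (fun i => ((loopHol (Averaging.iter (fun i => blockAvg (P := P) (j := i) (expMeanLogSU (n := n))) k U₀) c i :
              Matrix.specialUnitaryGroup n ℂ) : Matrix n n ℂ))
            (fun i => covWalkSum (Averaging.iter (fun i => blockAvg (P := P) (j := i) (expMeanLogSU (n := n))) k U₀) (Q k Y)
                (walk (emb c.src) (loopWord P.L c.dir (off i.1) i.2.1 i.2.2))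
              * ((loopHol (Averaging.iter (fun i => blockAvg (P := P) (j := i) (expMeanLogSU (n := n))) k U₀) c i :
                Matrix.specialUnitaryGroup n ℂ) : Matrix n n ℂ))
            * star ((corr (expMeanLogSU (n := n)) (Averaging.iter (fun i => blockAvg (P := P) (j := i) (expMeanLogSU (n := n))) k U₀) c :
                Matrix.specialUnitaryGroup n ℂ) : Matrix n n ℂ)
          + ((corr (expMeanLogSU (n := n)) (Averaging.iter (fun i => blockAvg (P := P) (j := i) (expMeanLogSU (n := n))) k U₀) c :
                Matrix.specialUnitaryGroup n ℂ) : Matrix n n ℂ)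
            * covWalkSum (Averaging.iter (fun i => blockAvg (P := P) (j := i) (expMeanLogSU (n := n))) k U₀) (Q k Y)
                (walk (emb c.src) (List.replicate P.L (c.dir, true)))
            * star ((corr (expMeanLogSU (n := n)) (Averaging.iter (fun i => blockAvg (P := P) (j := i) (expMeanLogSU (n := n))) k U₀) c :
                Matrix.specialUnitaryGroup n ℂ) : Matrix n n ℂ))
    (G : PBond P 0 → Matrix n n ℂ) (ξ : Site P 0 → Matrix n n ℂ) {k : ℕ}
    (hg : ∀ j < k, ∀ (c : PBond P (j + 1)) (i : Idx P),
        dist1 (loopHol (Averaging.iter (fun i => blockAvg (P := P) (j := i) (expMeanLogSU (n := n))) j U₀) c i) < deltaSU n)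
    (htan : ∀ c : PBond P k, Q k (fun b : PBond P 0 => G b + (ξ b.src - ((U₀ b : Matrix.specialUnitaryGroup n ℂ) : Matrix n n ℂ) * ξ b.tgt *
            star ((U₀ b : Matrix.specialUnitaryGroup n ℂ) : Matrix n n ℂ))) c = 0)
    (c : PBond P k) :
    ξ (embIter k c.src)
        - ((Averaging.iter (fun i => blockAvg (P := P) (j := i) (expMeanLogSU (n := n))) k U₀ c : Matrix.specialUnitaryGroup n ℂ) : Matrix n n ℂ)
          * ξ (embIter k c.tgt)
          * star ((Averaging.iter (fun i => blockAvg (P := P) (j := i) (expMeanLogSU (n := n))) k U₀ c : Matrix.specialUnitaryGroup n ℂ) : Matrix n n ℂ)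
      = -(Q k G c) := by
  have h := trueLinIter_add_pureGauge U₀ Q hQ0 hQs G ξ hg c
  rw [htan c] at h
  -- `0 = Q k G c + shadow` ⇒ `shadow = −Q k G c`
  have h' := (add_eq_zero_iff_neg_eq.mp h.symm)
  exact h'.symm

/-! ## §2 Norm and mass forms -/

/-- ★ Bondwise: the coarse gauge shadow of a fibre tangent has EXACTLY the norm of the average of its non-gauge part. [cite: Balaban1985Averaging, (11)-(13) p.19] -/
theorem norm_coarseGauge_eq_of_tangent (U₀ : GaugeField P 0 (Matrix.specialUnitaryGroup n ℂ))
    (Q : (k : ℕ) → (PBond P 0 → Matrix n n ℂ) → PBond P k → Matrix n n ℂ) (hQ0 : ∀ Y, Q 0 Y = Y)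
    (hQs : ∀ (k : ℕ) (Y : PBond P 0 → Matrix n n ℂ) (c : PBond P (k + 1)), Q (k + 1) Y c
      = fderiv ℂ (eml : (Idx P → Matrix n n ℂ) → Matrix n n ℂ)
            (fun i => ((loopHol (Averaging.iter (fun i => blockAvg (P := P) (j := i) (expMeanLogSU (n := n))) k U₀) c i :
              Matrix.specialUnitaryGroup n ℂ) : Matrix n n ℂ))
            (fun i => covWalkSum (Averaging.iter (fun i => blockAvg (P := P) (j := i) (expMeanLogSU (n := n))) k U₀) (Q k Y)
                (walk (emb c.src) (loopWord P.L c.dir (off i.1) i.2.1 i.2.2))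
              * ((loopHol (Averaging.iter (fun i => blockAvg (P := P) (j := i) (expMeanLogSU (n := n))) k U₀) c i :
                Matrix.specialUnitaryGroup n ℂ) : Matrix n n ℂ))
            * star ((corr (expMeanLogSU (n := n)) (Averaging.iter (fun i => blockAvg (P := P) (j := i) (expMeanLogSU (n := n))) k U₀) c :
                Matrix.specialUnitaryGroup n ℂ) : Matrix n n ℂ)
          + ((corr (expMeanLogSU (n := n)) (Averaging.iter (fun i => blockAvg (P := P) (j := i) (expMeanLogSU (n := n))) k U₀) c :
                Matrix.specialUnitaryGroup n ℂ) : Matrix n n ℂ)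
            * covWalkSum (Averaging.iter (fun i => blockAvg (P := P) (j := i) (expMeanLogSU (n := n))) k U₀) (Q k Y)
                (walk (emb c.src) (List.replicate P.L (c.dir, true)))
            * star ((corr (expMeanLogSU (n := n)) (Averaging.iter (fun i => blockAvg (P := P) (j := i) (expMeanLogSU (n := n))) k U₀) c :
                Matrix.specialUnitaryGroup n ℂ) : Matrix n n ℂ))
    (G : PBond P 0 → Matrix n n ℂ) (ξ : Site P 0 → Matrix n n ℂ) {k : ℕ}
    (hg : ∀ j < k, ∀ (c : PBond P (j + 1)) (i : Idx P),
        dist1 (loopHol (Averaging.iter (fun i => blockAvg (P := P) (j := i) (expMeanLogSU (n := n))) j U₀) c i) < deltaSU n)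
    (htan : ∀ c : PBond P k, Q k (fun b : PBond P 0 => G b + (ξ b.src - ((U₀ b : Matrix.specialUnitaryGroup n ℂ) : Matrix n n ℂ) * ξ b.tgt *
            star ((U₀ b : Matrix.specialUnitaryGroup n ℂ) : Matrix n n ℂ))) c = 0)
    (c : PBond P k) :
    ‖ξ (embIter k c.src)
        - ((Averaging.iter (fun i => blockAvg (P := P) (j := i) (expMeanLogSU (n := n))) k U₀ c : Matrix.specialUnitaryGroup n ℂ) : Matrix n n ℂ)
          * ξ (embIter k c.tgt)
          * star ((Averaging.iter (fun i => blockAvg (P := P) (j := i) (expMeanLogSU (n := n))) k U₀ c : Matrix.specialUnitaryGroup n ℂ) : Matrix n n ℂ)‖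
      = ‖Q k G c‖ := by
  rw [coarseGauge_eq_neg_avg_of_tangent U₀ Q hQ0 hQs G ξ hg htan c, norm_neg]

/-- ★ `ℓ²` form: the coarse mass of the gauge shadow equals the coarse mass of the average of the non-gauge part (sum over ANY finite set of level-`k` bonds).
[cite: Balaban1985Averaging, (11)-(13) p.19] -/
theorem sum_normSq_coarseGauge_eq_of_tangent (U₀ : GaugeField P 0 (Matrix.specialUnitaryGroup n ℂ))
    (Q : (k : ℕ) → (PBond P 0 → Matrix n n ℂ) → PBond P k → Matrix n n ℂ) (hQ0 : ∀ Y, Q 0 Y = Y)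
    (hQs : ∀ (k : ℕ) (Y : PBond P 0 → Matrix n n ℂ) (c : PBond P (k + 1)), Q (k + 1) Y c
      = fderiv ℂ (eml : (Idx P → Matrix n n ℂ) → Matrix n n ℂ)
            (fun i => ((loopHol (Averaging.iter (fun i => blockAvg (P := P) (j := i) (expMeanLogSU (n := n))) k U₀) c i :
              Matrix.specialUnitaryGroup n ℂ) : Matrix n n ℂ))
            (fun i => covWalkSum (Averaging.iter (fun i => blockAvg (P := P) (j := i) (expMeanLogSU (n := n))) k U₀) (Q k Y)
                (walk (emb c.src) (loopWord P.L c.dir (off i.1) i.2.1 i.2.2))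
              * ((loopHol (Averaging.iter (fun i => blockAvg (P := P) (j := i) (expMeanLogSU (n := n))) k U₀) c i :
                Matrix.specialUnitaryGroup n ℂ) : Matrix n n ℂ))
            * star ((corr (expMeanLogSU (n := n)) (Averaging.iter (fun i => blockAvg (P := P) (j := i) (expMeanLogSU (n := n))) k U₀) c :
                Matrix.specialUnitaryGroup n ℂ) : Matrix n n ℂ)
          + ((corr (expMeanLogSU (n := n)) (Averaging.iter (fun i => blockAvg (P := P) (j := i) (expMeanLogSU (n := n))) k U₀) c :
                Matrix.specialUnitaryGroup n ℂ) : Matrix n n ℂ)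
            * covWalkSum (Averaging.iter (fun i => blockAvg (P := P) (j := i) (expMeanLogSU (n := n))) k U₀) (Q k Y)
                (walk (emb c.src) (List.replicate P.L (c.dir, true)))
            * star ((corr (expMeanLogSU (n := n)) (Averaging.iter (fun i => blockAvg (P := P) (j := i) (expMeanLogSU (n := n))) k U₀) c :
                Matrix.specialUnitaryGroup n ℂ) : Matrix n n ℂ))
    (G : PBond P 0 → Matrix n n ℂ) (ξ : Site P 0 → Matrix n n ℂ) {k : ℕ}
    (hg : ∀ j < k, ∀ (c : PBond P (j + 1)) (i : Idx P),
        dist1 (loopHol (Averaging.iter (fun i => blockAvg (P := P) (j := i) (expMeanLogSU (n := n))) j U₀) c i) < deltaSU n)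
    (htan : ∀ c : PBond P k, Q k (fun b : PBond P 0 => G b + (ξ b.src - ((U₀ b : Matrix.specialUnitaryGroup n ℂ) : Matrix n n ℂ) * ξ b.tgt *
            star ((U₀ b : Matrix.specialUnitaryGroup n ℂ) : Matrix n n ℂ))) c = 0)
    (S : Finset (PBond P k)) :
    ∑ c ∈ S, ‖ξ (embIter k c.src)
        - ((Averaging.iter (fun i => blockAvg (P := P) (j := i) (expMeanLogSU (n := n))) k U₀ c : Matrix.specialUnitaryGroup n ℂ) : Matrix n n ℂ)
          * ξ (embIter k c.tgt)
          * star ((Averaging.iter (fun i => blockAvg (P := P) (j := i) (expMeanLogSU (n := n))) k U₀ c : Matrix.specialUnitaryGroup n ℂ) : Matrix n n ℂ)‖ ^ 2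
      = ∑ c ∈ S, ‖Q k G c‖ ^ 2 := by
  refine Finset.sum_congr rfl fun c _ => ?_
  rw [norm_coarseGauge_eq_of_tangent U₀ Q hQ0 hQs G ξ hg htan c]

/-! ## §3 The near-constant lift of a rotation is as small as the background's distance to `1` -/

/-- ★ Summed over any finite set of bonds: `Σ_b ‖K − U_b K U_b*‖² ≤ 4‖K‖²·Σ_b ‖U_b − 1‖²` — the mass of the gauge mode of a constant rotation is controlled by the
background's `ℓ²`-distance to the trivial field (so at a SMOOTH background a lifted rotation carries little fine-level mass). [folklore] -/
theorem sum_normSq_constLift_le {j : ℕ} (U₀ : GaugeField P j (Matrix.specialUnitaryGroup n ℂ)) (K : Matrix n n ℂ) (S : Finset (PBond P j)) :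
    ∑ b ∈ S, ‖K - ((U₀ b : Matrix.specialUnitaryGroup n ℂ) : Matrix n n ℂ) * K * star ((U₀ b : Matrix.specialUnitaryGroup n ℂ) : Matrix n n ℂ)‖ ^ 2
      ≤ 4 * ‖K‖ ^ 2 * ∑ b ∈ S, ‖((U₀ b : Matrix.specialUnitaryGroup n ℂ) : Matrix n n ℂ) - 1‖ ^ 2 := by
  rw [Finset.mul_sum]
  refine Finset.sum_le_sum fun b _ => ?_
  have h := norm_sub_conj_le (U₀ b) K
  have h0 : 0 ≤ ‖K - ((U₀ b : Matrix.specialUnitaryGroup n ℂ) : Matrix n n ℂ) * K * star ((U₀ b : Matrix.specialUnitaryGroup n ℂ) : Matrix n n ℂ)‖ :=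
    norm_nonneg _
  have h1 : 0 ≤ 2 * ‖((U₀ b : Matrix.specialUnitaryGroup n ℂ) : Matrix n n ℂ) - 1‖ * ‖K‖ := by positivity
  calc ‖K - ((U₀ b : Matrix.specialUnitaryGroup n ℂ) : Matrix n n ℂ) * K * star ((U₀ b : Matrix.specialUnitaryGroup n ℂ) : Matrix n n ℂ)‖ ^ 2
      ≤ (2 * ‖((U₀ b : Matrix.specialUnitaryGroup n ℂ) : Matrix n n ℂ) - 1‖ * ‖K‖) ^ 2 := pow_le_pow_left₀ h0 h 2
    _ = 4 * ‖K‖ ^ 2 * ‖((U₀ b : Matrix.specialUnitaryGroup n ℂ) : Matrix n n ℂ) - 1‖ ^ 2 := by ring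


/-! ## §4 v1.1 (★routeR-w1 g2, append-only; ★★OWNER ACK 50 (3)): the operator-norm transfer, `ker Q_k ∩ im P_{U₀}`, and the near-STABILISER twin of §3 -/

/-- ★ **OPERATOR-NORM TRANSFER**: any `ℓ²` bound `Σ_{c∈S}‖Q k G c‖² ≤ C·Σ_b‖G b‖²` on the average of the NON-gauge part of a fibre tangent `Y = G + P_{U₀}ξ` bounds the coarse
gauge shadow VERBATIM: `Σ_{c∈S}‖P_{Ū₀^{(k)}}(ξ ∘ embIter k)(c)‖² ≤ C·Σ_b‖G b‖²` (§2 + the displayed bound; the bound itself is the F-chain's ∕ the one-step row's).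
[cite: Balaban1985Averaging, (11)-(13) p.19, (124) p.36] -/
theorem sum_normSq_coarseGauge_le_of_tangent (U₀ : GaugeField P 0 (Matrix.specialUnitaryGroup n ℂ))
    (Q : (k : ℕ) → (PBond P 0 → Matrix n n ℂ) → PBond P k → Matrix n n ℂ) (hQ0 : ∀ Y, Q 0 Y = Y)
    (hQs : ∀ (k : ℕ) (Y : PBond P 0 → Matrix n n ℂ) (c : PBond P (k + 1)), Q (k + 1) Y c
      = fderiv ℂ (eml : (Idx P → Matrix n n ℂ) → Matrix n n ℂ)
            (fun i => ((loopHol (Averaging.iter (fun i => blockAvg (P := P) (j := i) (expMeanLogSU (n := n))) k U₀) c i :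
              Matrix.specialUnitaryGroup n ℂ) : Matrix n n ℂ))
            (fun i => covWalkSum (Averaging.iter (fun i => blockAvg (P := P) (j := i) (expMeanLogSU (n := n))) k U₀) (Q k Y)
                (walk (emb c.src) (loopWord P.L c.dir (off i.1) i.2.1 i.2.2))
              * ((loopHol (Averaging.iter (fun i => blockAvg (P := P) (j := i) (expMeanLogSU (n := n))) k U₀) c i :
                Matrix.specialUnitaryGroup n ℂ) : Matrix n n ℂ))
            * star ((corr (expMeanLogSU (n := n)) (Averaging.iter (fun i => blockAvg (P := P) (j := i) (expMeanLogSU (n := n))) k U₀) c :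
                Matrix.specialUnitaryGroup n ℂ) : Matrix n n ℂ)
          + ((corr (expMeanLogSU (n := n)) (Averaging.iter (fun i => blockAvg (P := P) (j := i) (expMeanLogSU (n := n))) k U₀) c :
                Matrix.specialUnitaryGroup n ℂ) : Matrix n n ℂ)
            * covWalkSum (Averaging.iter (fun i => blockAvg (P := P) (j := i) (expMeanLogSU (n := n))) k U₀) (Q k Y)
                (walk (emb c.src) (List.replicate P.L (c.dir, true)))
            * star ((corr (expMeanLogSU (n := n)) (Averaging.iter (fun i => blockAvg (P := P) (j := i) (expMeanLogSU (n := n))) k U₀) c :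
                Matrix.specialUnitaryGroup n ℂ) : Matrix n n ℂ))
    (G : PBond P 0 → Matrix n n ℂ) (ξ : Site P 0 → Matrix n n ℂ) {k : ℕ}
    (hg : ∀ j < k, ∀ (c : PBond P (j + 1)) (i : Idx P),
        dist1 (loopHol (Averaging.iter (fun i => blockAvg (P := P) (j := i) (expMeanLogSU (n := n))) j U₀) c i) < deltaSU n)
    (htan : ∀ c : PBond P k, Q k (fun b : PBond P 0 => G b + (ξ b.src - ((U₀ b : Matrix.specialUnitaryGroup n ℂ) : Matrix n n ℂ) * ξ b.tgt *
            star ((U₀ b : Matrix.specialUnitaryGroup n ℂ) : Matrix n n ℂ))) c = 0)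
    (S : Finset (PBond P k)) {C : ℝ} (hQG : ∑ c ∈ S, ‖Q k G c‖ ^ 2 ≤ C * ∑ b : PBond P 0, ‖G b‖ ^ 2) :
    ∑ c ∈ S, ‖(ξ (embIter k c.src)
        - (((Averaging.iter (fun i => blockAvg (P := P) (j := i) (expMeanLogSU (n := n))) k U₀ c : Matrix.specialUnitaryGroup n ℂ)) : Matrix n n ℂ)
          * ξ (embIter k c.tgt)
          * star (((Averaging.iter (fun i => blockAvg (P := P) (j := i) (expMeanLogSU (n := n))) k U₀ c : Matrix.specialUnitaryGroup n ℂ)) : Matrix n n ℂ))‖ ^ 2 ≤ C * ∑ b : PBond P 0, ‖G b‖ ^ 2 := by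
  rw [sum_normSq_coarseGauge_eq_of_tangent U₀ Q hQ0 hQs G ξ hg htan S]
  exact hQG

/-- ★ **`ker Q_k ∩ im P_{U₀}` = THE COVARIANTLY CONSTANT DESCENTS**: a pure gauge `P_{U₀}ξ` is a fibre tangent at the coarse bond `c` (`Q k (P_{U₀}ξ) c = 0`) iff its descended
gauge function is `Ū₀^{(k)}`-covariantly constant across `c`: `ξ(embIter k c₋) = Ū₀^{(k)}(c)·ξ(embIter k c₊)·Ū₀^{(k)}(c)^*` — for an irreducible `Ū₀^{(k)}` and traceless `ξ`,
iff `ξ` vanishes at the centres (the Lie algebra of the pinned group (4)); this is the letter in which a zero mode of the Landau quotient is read.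
[cite: Balaban1985Variational, (4) p.278; Balaban1985Averaging, (11)-(13) p.19] -/
theorem trueLinIter_pureGauge_eq_zero_iff (U₀ : GaugeField P 0 (Matrix.specialUnitaryGroup n ℂ))
    (Q : (k : ℕ) → (PBond P 0 → Matrix n n ℂ) → PBond P k → Matrix n n ℂ) (hQ0 : ∀ Y, Q 0 Y = Y)
    (hQs : ∀ (k : ℕ) (Y : PBond P 0 → Matrix n n ℂ) (c : PBond P (k + 1)), Q (k + 1) Y c
      = fderiv ℂ (eml : (Idx P → Matrix n n ℂ) → Matrix n n ℂ)
            (fun i => ((loopHol (Averaging.iter (fun i => blockAvg (P := P) (j := i) (expMeanLogSU (n := n))) k U₀) c i :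
              Matrix.specialUnitaryGroup n ℂ) : Matrix n n ℂ))
            (fun i => covWalkSum (Averaging.iter (fun i => blockAvg (P := P) (j := i) (expMeanLogSU (n := n))) k U₀) (Q k Y)
                (walk (emb c.src) (loopWord P.L c.dir (off i.1) i.2.1 i.2.2))
              * ((loopHol (Averaging.iter (fun i => blockAvg (P := P) (j := i) (expMeanLogSU (n := n))) k U₀) c i :
                Matrix.specialUnitaryGroup n ℂ) : Matrix n n ℂ))
            * star ((corr (expMeanLogSU (n := n)) (Averaging.iter (fun i => blockAvg (P := P) (j := i) (expMeanLogSU (n := n))) k U₀) c :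
                Matrix.specialUnitaryGroup n ℂ) : Matrix n n ℂ)
          + ((corr (expMeanLogSU (n := n)) (Averaging.iter (fun i => blockAvg (P := P) (j := i) (expMeanLogSU (n := n))) k U₀) c :
                Matrix.specialUnitaryGroup n ℂ) : Matrix n n ℂ)
            * covWalkSum (Averaging.iter (fun i => blockAvg (P := P) (j := i) (expMeanLogSU (n := n))) k U₀) (Q k Y)
                (walk (emb c.src) (List.replicate P.L (c.dir, true)))
            * star ((corr (expMeanLogSU (n := n)) (Averaging.iter (fun i => blockAvg (P := P) (j := i) (expMeanLogSU (n := n))) k U₀) c :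
                Matrix.specialUnitaryGroup n ℂ) : Matrix n n ℂ))
    (ξ : Site P 0 → Matrix n n ℂ) {k : ℕ}
    (hg : ∀ j < k, ∀ (c : PBond P (j + 1)) (i : Idx P),
        dist1 (loopHol (Averaging.iter (fun i => blockAvg (P := P) (j := i) (expMeanLogSU (n := n))) j U₀) c i) < deltaSU n)
    (c : PBond P k) :
    Q k (fun b : PBond P 0 => ξ b.src - ((U₀ b : Matrix.specialUnitaryGroup n ℂ) : Matrix n n ℂ) * ξ b.tgt *
            star ((U₀ b : Matrix.specialUnitaryGroup n ℂ) : Matrix n n ℂ)) c = 0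
      ↔ ξ (embIter k c.src) = (((Averaging.iter (fun i => blockAvg (P := P) (j := i) (expMeanLogSU (n := n))) k U₀ c : Matrix.specialUnitaryGroup n ℂ)) : Matrix n n ℂ) * ξ (embIter k c.tgt) * star (((Averaging.iter (fun i => blockAvg (P := P) (j := i) (expMeanLogSU (n := n))) k U₀ c : Matrix.specialUnitaryGroup n ℂ)) : Matrix n n ℂ) := by
  rw [Prop7TrueLinPureGaugeIter.trueLinIter_pureGauge U₀ Q hQ0 hQs ξ k hg c, sub_eq_zero]

omit [Nonempty n] in
/-- ★ **THE NEAR-STABILISER TWIN OF §3**: for a constant `K` COMMUTING with a reference `V₀` (`K ∈ 𝔰𝔱𝔞𝔟(V₀)`), `‖K − U_bKU_b^*‖ ≤ 2‖K‖·‖U_b − V₀‖` — the lifted rotation costs the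
background's distance from the STABILISED datum, not from `1` (the `θ_V` letter of CARD-g12 §2′). [cite: Balaban1985Averaging, (8) p.19] -/
theorem norm_constLift_le_of_commute {j : ℕ} (U₀ : GaugeField P j (Matrix.specialUnitaryGroup n ℂ)) (K V₀ : Matrix n n ℂ) (hKV : K * V₀ = V₀ * K)
    (b : PBond P j) :
    ‖K - ((U₀ b : Matrix.specialUnitaryGroup n ℂ) : Matrix n n ℂ) * K * star ((U₀ b : Matrix.specialUnitaryGroup n ℂ) : Matrix n n ℂ)‖
      ≤ 2 * ‖K‖ * ‖((U₀ b : Matrix.specialUnitaryGroup n ℂ) : Matrix n n ℂ) - V₀‖ := by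
  have e1 : K - ((U₀ b : Matrix.specialUnitaryGroup n ℂ) : Matrix n n ℂ) * K * star ((U₀ b : Matrix.specialUnitaryGroup n ℂ) : Matrix n n ℂ)
      = (K * ((U₀ b : Matrix.specialUnitaryGroup n ℂ) : Matrix n n ℂ) - ((U₀ b : Matrix.specialUnitaryGroup n ℂ) : Matrix n n ℂ) * K)
          * star ((U₀ b : Matrix.specialUnitaryGroup n ℂ) : Matrix n n ℂ) := by
    rw [sub_mul, mul_assoc K, Unitary.mul_star_self_of_mem (U₀ b).2.1, mul_one]
  have e2 : K * ((U₀ b : Matrix.specialUnitaryGroup n ℂ) : Matrix n n ℂ) - ((U₀ b : Matrix.specialUnitaryGroup n ℂ) : Matrix n n ℂ) * K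
      = K * (((U₀ b : Matrix.specialUnitaryGroup n ℂ) : Matrix n n ℂ) - V₀) - (((U₀ b : Matrix.specialUnitaryGroup n ℂ) : Matrix n n ℂ) - V₀) * K := by
    rw [Matrix.mul_sub, Matrix.sub_mul, hKV]; abel
  rw [e1, CStarRing.norm_mul_mem_unitary _ (Unitary.star_mem (U₀ b).2.1), e2]
  refine (norm_sub_le _ _).trans ?_
  have h1 : ‖K * (((U₀ b : Matrix.specialUnitaryGroup n ℂ) : Matrix n n ℂ) - V₀)‖ ≤ ‖K‖ * ‖((U₀ b : Matrix.specialUnitaryGroup n ℂ) : Matrix n n ℂ) - V₀‖ := norm_mul_le _ _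
  have h2 : ‖(((U₀ b : Matrix.specialUnitaryGroup n ℂ) : Matrix n n ℂ) - V₀) * K‖ ≤ ‖((U₀ b : Matrix.specialUnitaryGroup n ℂ) : Matrix n n ℂ) - V₀‖ * ‖K‖ := norm_mul_le _ _
  nlinarith [norm_nonneg K, norm_nonneg (((U₀ b : Matrix.specialUnitaryGroup n ℂ) : Matrix n n ℂ) - V₀)]

omit [Nonempty n] in
/-- ★ … summed: `Σ_{b∈S}‖K − U_bKU_b^*‖² ≤ 4‖K‖²·Σ_{b∈S}‖U_b − V₀‖²` for `K` commuting with `V₀`. [cite: Balaban1985Averaging, (8) p.19] -/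
theorem sum_normSq_constLift_le_of_commute {j : ℕ} (U₀ : GaugeField P j (Matrix.specialUnitaryGroup n ℂ)) (K V₀ : Matrix n n ℂ) (hKV : K * V₀ = V₀ * K)
    (S : Finset (PBond P j)) :
    ∑ b ∈ S, ‖K - ((U₀ b : Matrix.specialUnitaryGroup n ℂ) : Matrix n n ℂ) * K * star ((U₀ b : Matrix.specialUnitaryGroup n ℂ) : Matrix n n ℂ)‖ ^ 2
      ≤ 4 * ‖K‖ ^ 2 * ∑ b ∈ S, ‖((U₀ b : Matrix.specialUnitaryGroup n ℂ) : Matrix n n ℂ) - V₀‖ ^ 2 := by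
  rw [Finset.mul_sum]
  refine Finset.sum_le_sum fun b _ => ?_
  have h := norm_constLift_le_of_commute U₀ K V₀ hKV b
  have h1 : 0 ≤ 2 * ‖K‖ * ‖((U₀ b : Matrix.specialUnitaryGroup n ℂ) : Matrix n n ℂ) - V₀‖ := by positivity
  calc ‖K - ((U₀ b : Matrix.specialUnitaryGroup n ℂ) : Matrix n n ℂ) * K * star ((U₀ b : Matrix.specialUnitaryGroup n ℂ) : Matrix n n ℂ)‖ ^ 2
      ≤ (2 * ‖K‖ * ‖((U₀ b : Matrix.specialUnitaryGroup n ℂ) : Matrix n n ℂ) - V₀‖) ^ 2 := pow_le_pow_left₀ (norm_nonneg _) h 2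
    _ = 4 * ‖K‖ ^ 2 * ‖((U₀ b : Matrix.specialUnitaryGroup n ℂ) : Matrix n n ℂ) - V₀‖ ^ 2 := by ring

end Summit.QuantumFields.YangMills.Theorems.Prop7FibreGaugeTransversality

end
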